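import Literature.Probability.Percolation.ArmSeparationIntFenceBound
import Literature.Probability.Percolation.ArmSeparationFenceBoundAt
import HarnessLib

/-!
# The union bound of the separation step at INTERNAL extremities, at a general density `p`

Topic: Probability / Percolation; family `crit-perc` / near-critical percolation on `𝕋`
(`P_p = triSitePercolation p`, ANY `p : unitInterval`). `ArmSeparationIntFenceBound.lean` proves
the union bound of Kesten's separation step at the internal extremities (Nolin 2008, §4.4, proof of
Lemma 15, internal case [arXiv 0711.4948: Lemma 14, (4.18)–(4.19)]) at `p = 1/2` with unrestricted
frame hypotheses `∀ z k, 1 ≤ k → c_F ≤ P_{1/2}(triFrameAt z k)`. Below the characteristic length the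
frames of `P_p` are only available up to a scale `S` (RSW below `L(p)`, Nolin §3.1), which is all
the proof uses: the scales read are `k_j = k₀ · 32^j` and `8 k_j`, `j < K`. This file re-runs the
three probabilistic statements at a general `p` with the capped frame hypothesis
`hF : ∀ z k, 1 ≤ k → k < S → c_F ≤ P_p(triFrameAt z k)` and `8 k_j < S` (`j < K`):

* `real_compl_rswOff_le_at` — `P_p((RSWOff L z k₀ K)ᶜ) ≤ (1 - c_F²)^K`
  (`real_iInter_compl_trapRSW_le_at`, `ArmSeparationFenceBoundAt.lean`);
* `real_compl_intProt_le_at` — the same for the protecting event `intProt` of a value `(c, z)`;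
* `real_intSeqFail_le_at` — **the union bound** `P_p(IntSeqFail m T k₀ K r) ≤ T (1 - c_F²)^K`
  (`m ≥ 5`, `2 k_j + 1 ≤ r`), by the abstract union bound with conditional independence
  `JDomain.real_exists_lowestSeq_not_mem_le` (stated for every `p` in `TriLowestCrossingProb.lean`).

The events (`RSWOff`, `IntFenceOK`, `IntSeqFail`, `intProt`) and their locality are those of
`ArmSeparationIntFenceBound.lean`, imported. Everything here is proved; no named facts are introduced.

## References

* P. Nolin, *Near-critical percolation in two dimensions*, Electron. J. Probab. 13 (2008), Thm. 11
  ("uniformly in `p` … `n ≤ N ≤ L(p)`") and §4.4, proof of Lemma 15, internal extremities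
  [arXiv 0711.4948: Thm. 10, Lemma 14, (4.18)–(4.19)]. [Nolin2008]
* H. Kesten, *Scaling relations for 2D-percolation*, Comm. Math. Phys. 109 (1987), Lemma 2. [Kesten1987]

Tree: `RSWOff`, `compl_rswOff_subset`, `intProt`, `determinedBy_intProt`, `IntSeqFail`,
`not_mem_intProt_of_fail` (`ArmSeparationIntFenceBound.lean`); `real_iInter_compl_trapRSW_le_at`,
`sq_le_real_trapRSW_at` (`ArmSeparationFenceBoundAt.lean`); `HalfAnnulus.intDom_cutProp/dualProp`
(`TriHalfAnnulus.lean`); `JDomain.real_exists_lowestSeq_not_mem_le` (`TriLowestCrossingProb.lean`).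
-/

noncomputable section

open MeasureTheory Set
open scoped unitInterval

namespace Literature.Probability.Percolation

open LatticeModels HalfAnnulus

/-- **`P_p((RSWOff L z k₀ K)ᶜ) ≤ (1 - c_F²)^K`** at density `p`, from open frames of probability
`≥ c_F` at the scales `< S`, `8 k_j < S` for `j < K` (`real_iInter_compl_trapRSW_le_at`). [cite: Nolin2008, §4.4 Lemma 15 (proof) (arXiv 0711.4948: Lemma 14, (4.18)), with Thm. 11 "uniformly in p"] -/
theorem real_compl_rswOff_le_at (p : unitInterval) {cF : ℝ} (hcF : 0 < cF) {S : ℕ}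
    (hF : ∀ (z : Site 2) (k : ℕ), 1 ≤ k → k < S → cF ≤ (triSitePercolation p).real (triFrameAt z k))
    (L : Finset (Site 2)) (z : Site 2) {k₀ : ℕ} (hk₀ : 1 ≤ k₀) {K : ℕ} (hKS : ∀ j < K, 8 * trapScale k₀ j < S) :
    (triSitePercolation p).real (RSWOff L z k₀ K)ᶜ ≤ (1 - cF ^ 2) ^ K :=
  (measureReal_mono (compl_rswOff_subset L z k₀ K)).trans (real_iInter_compl_trapRSW_le_at p hcF hF z hk₀ K hKS).1

/-- `P_p((intProt)ᶜ) ≤ (1 - c_F²)^K` at density `p` (`c_F ≤ 1`, frames as in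
`real_compl_rswOff_le_at`). [cite: Nolin2008, §4.4 Lemma 15 (proof) (arXiv 0711.4948: Lemma 14, (4.18)), with Thm. 11 "uniformly in p"] -/
theorem real_compl_intProt_le_at (p : unitInterval) {cF : ℝ} (hcF : 0 < cF) (hcF1 : cF ≤ 1) {S : ℕ}
    (hF : ∀ (z : Site 2) (k : ℕ), 1 ≤ k → k < S → cF ≤ (triSitePercolation p).real (triFrameAt z k))
    (m : ℕ) {k₀ : ℕ} (hk₀ : 1 ≤ k₀) {K : ℕ} (hKS : ∀ j < K, 8 * trapScale k₀ j < S) (r : ℕ)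
    (c : Finset (Site 2)) (z : Site 2) :
    (triSitePercolation p).real (intProt m k₀ K r c z)ᶜ ≤ (1 - cF ^ 2) ^ K := by
  by_cases h : IntMidTip m r z
  · have : intProt m k₀ K r c z = RSWOff ((intDom m).lower c z) z k₀ K := by
      ext ω; simp only [intProt, Set.mem_setOf_eq]; exact ⟨fun h' => h' h, fun h' _ => h'⟩
    rw [this]
    exact real_compl_rswOff_le_at p hcF hF _ z hk₀ hKS
  · have : intProt m k₀ K r c z = Set.univ := by
      ext ω; simp only [intProt, Set.mem_setOf_eq, Set.mem_univ, iff_true]; exact fun h' => absurd h' h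
    rw [this, Set.compl_univ, measureReal_empty]
    exact pow_nonneg (by nlinarith) K

/-- **The union bound at internal extremities, at density `p`** (Nolin 2008, (4.18)–(4.19),
internal case, "for any `p`, any `P̂` between `P_p` and `P_{1-p}` and any `N ≤ L(p)`"):
`P_p(IntSeqFail m T k₀ K r) ≤ T (1 - c_F²)^K` for `m ≥ 5`, `k₀ ≥ 1`, `2 k_j + 1 ≤ r` and `8 k_j < S`
(`j < K`), given open frames of probability `≥ c_F ∈ (0, 1]` at `p` at the scales `< S` — the
abstract union bound with conditional independence `JDomain.real_exists_lowestSeq_not_mem_le` (any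
product measure) for the protecting events `intProt`. [cite: Nolin2008, §4.4 Lemma 15 (proof) (arXiv 0711.4948: Lemma 14, (4.19)), with Thm. 11 "uniformly in p"] -/
theorem real_intSeqFail_le_at (p : unitInterval) {cF : ℝ} (hcF : 0 < cF) (hcF1 : cF ≤ 1) {S : ℕ}
    (hF : ∀ (z : Site 2) (k : ℕ), 1 ≤ k → k < S → cF ≤ (triSitePercolation p).real (triFrameAt z k))
    {m T k₀ K r : ℕ} (hm : 5 ≤ m) (hk₀ : 1 ≤ k₀) (hKr : ∀ j < K, 2 * trapScale k₀ j + 1 ≤ r)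
    (hKS : ∀ j < K, 8 * trapScale k₀ j < S) :
    (triSitePercolation p).real {ω | IntSeqFail m T k₀ K r ω} ≤ T * (1 - cF ^ 2) ^ K := by
  have hcut := intDom_cutProp hm
  have hdual := intDom_dualProp hm
  have h0 : 0 ≤ (1 - cF ^ 2) ^ K := pow_nonneg (by nlinarith) K
  have key := JDomain.real_exists_lowestSeq_not_mem_le hcut hdual p (Prot := intProt m k₀ K r)
    (G := fun c z => trapScalesFinset z k₀ K \ (intDom m).lower c z) h0
    (fun c z _ => determinedBy_intProt m k₀ K r c z) (fun c z _ => Finset.disjoint_sdiff)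
    (fun c z _ => by
      have := real_compl_intProt_le_at p hcF hcF1 hF m hk₀ hKS r c z
      unfold triSitePercolation at this
      exact this) T
  unfold triSitePercolation
  refine le_trans (measureReal_mono ?_) key
  rintro ω ⟨u, hu, c, z, h, hmid, hfail⟩
  exact ⟨u, hu, c, z, h, not_mem_intProt_of_fail hm hk₀ hKr h hmid hfail⟩

end Literature.Probability.Percolation
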